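import Summits.ABC.IUTFork.Repair.RHReqsideWeightLawsThreshold
import HarnessLib

/-!
# D-0122 AXIS B, knob k1 (Θ-data ⇒ WEIGHT LAW) — THE TYPED FORM, part 3: **`T(κ, ·)` AS A THEOREM** — the place-level exact
# tier-L0 threshold `T_f(w)` of the k1-cell is MONOTONE IN THE PILOT LAW (the SIGN of every k1 row), VANISHES iff every label is
# licensed, scales homogeneously along the `l`-tower (k4), and couples to the k5 target by `T(μ₀) ≤ μ₀·T(1)`

abc-iut cell, rung LADDER-ABC:A2.RESCUE.H; seat abc-iut-reqb-typ-1 (GEN 3; D-0122 axis B typer k1/k4, director-abc g4-D24 payload «typed form of the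
k1/k4 modifications … with `T(κ,·)` as a theorem»); owner abc-iut-rh-lead g3/g4 (`plan/rescue/R-H/ROUND3/REQB-SPEC.md` v0.2 §1 k1/k4/k5, §6(a)(P2)
«`T_mod := (Req_mod − K_L0,mod)⁺`», (P4) T-words); table of record `REQB-TABLE.tsv` v1 b8ac679ede5d795b; referee abc-iut-reqb-ref-1. Parts 1/2 =
`Repair/RHReqsideWeightLaws.lean` p506542 (laws `lawPow a = ⌈j^{a/2}⌉`, `lawShift`, `lawAffine`, the k1-cell `Cell f den`, pilot antitonicity
`cell_of_le_of_cell`, saturation laws, `demandSum` closed forms) and `Repair/RHReqsideWeightLawsThreshold.lean` p508156 (`reqMass`, `reqThreshold`,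
`uConst`); bed rows p508362/p512285 (`κ = 1`), p513467/p514474 (`κ = 3/2`). Nothing re-typed; all statements BY NAME over those.

WHY THIS FILE. REQB-SPEC (P2)/(P4) words the requirement side by `T_mod = (μ₀·M_mod − K_L0,mod)⁺` per datum and its ratio to print. Parts 1/2 typed `M_mod`
(`(f, l)`-only) and the cell; the KEPT side `K_L0 = Σ_{licensed cells} d_j u_w` and hence `T` itself were left to the engines. Here `T` is typed EXACTLY at the
place (tier L0 = licence information, no netting; NO «seg = 1» assumption — the kept set is the set of licensed labels whatever its shape) and the one structural
fact the table's T-column exhibits for EVERY k1 row is proved: **a smaller pilot law never raises `T`** (reqb-typ-2's `ReqsideShellProfile.sliceBoundary_le_of_imp`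
p507493 is the k3 analogue «tightening never lowers `T`»).
* §1 CELL COMPARISONS for a general law: cross-denominator pilot antitonicity `cell_of_mul_le_of_cell` (`f/den ≤ g/den′`: `Cell g den′ ⟹ Cell f den`; covers
  affine `c₁ = 1/2`); k4 HOMOGENEITY `cell_scale` (scaling `(e, m, δ, r_in, r_out)` by `t > 0` leaves EVERY law's cell unchanged — typ-2's `hullCellδ_scale` is
  the print case) and `cell_lProfile_mono` (at fixed depth a scaled place licenses more); k1 × k3 compatibility `cell_mono_shell` (a looser shell licenses more
  under every law); law order facts `sq_le_lawShift` (`j² ≤ (j+a)² − (1+a)² + 1`, `j ≥ 1`), `sq_le_lawAffine` (`c ≥ 1`), `one_le_lawPow`.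
* §2 THE PLACE THRESHOLD `offDemand f den e m δ r_in r_out L := Σ_{j ≤ L, ¬Cell_j} (f(j) − den)` (`= den·T_f(w)/(m_q u_w)`: `T_f(w) = M_f(w) − K_{L0,f}(w)`)
  and the kept demand `keptDemand` (`= den·K_{L0,f}(w)/(m_q u_w)`), `keptDemand + offDemand = demandSum` (`M = K_L0 + T`), `0 ≤ T ≤ M`;
  **`offDemand_mono_law` — THE k1 SIGN THEOREM: `den ≤ f ≤ g` on labels `≥ 1`, `m ≥ 0` ⟹ `T_f(w) ≤ T_g(w)`** (cross-denominator: `offDemand_mono_law_den`, `den′ ≤ g`);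
  `offDemand_eq_zero_iff` (**VANISHES ⟺ every label with positive demand is licensed**) and `offDemand_eq_of_boundary` / `keptDemand_eq_of_boundary`
  (on a segment place `{1..j₀}`: `T = demandSum L − demandSum j₀`, `K_L0 = demandSum j₀` — the closed forms of part 1 then give the numbers);
  THE κ-CHAIN `T(κ=1) ≤ T(3/2) ≤ T(2) = T_print ≤ T(5/2) ≤ T(3)` (`offDemand_kappa_chain`), `T_print ≤ T_shift(a)`, `T_print ≤ T_affine(c ≥ 1)`,
  `T_affine(½) ≤ 2·T_print` (label units; in mass units `≤ T_print`) — i.e. the sign of the T-word of rows S-k1-kappa1, S-k1-kappa3/2, S-k1-affine1/2 (REDUCES side)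
  and S-k1-kappa5/2, S-k1-shift1, S-k1-shift2, S-k1-affine2 (INCREASES side) of REQB-TABLE v1 is a theorem of the typed functional, the magnitudes are the engines';
  SATURATION ⟹ VANISHES under `κ = 1` (`m ≤ δ + G`, an `L`-FREE condition: the k1 × k4 reading «at every `l`»), `κ = 3/2` (`⌈√L⌉m ≤ δ + G`), print (`L·m ≤ δ + G`).
* Part 3b (`Repair/RHReqsideWeightLawsSignDatum.lean`, this seat): the DATUM-LEVEL sums `datumOff` / `datumKept` (monotone in the law, `= 0 ⟺` every
  place vanishes), the k5 coupling over `reqThreshold` (`T(1) = T`, `T(μ₀) ≤ μ₀·T`, the tier-L0 «ratio ≥ 1» cell `μ₀·T ≤ (1 − μ₀)·K`), and the worked place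
  FREY `p = 7`, `l = 107` (`T_print = 40601`, `T_{κ=1} = T_{κ=3/2} = 0`, `T_shift1 = 44404`, `T_affine2 = 99560` in label units).
HONEST FRAMING: integer/real arithmetic about OUR typed cell with a free pilot law (a PARAMETER — REQB-SPEC FRAMING; whether IUT I–III admit any law other
than `j²` is the CONSISTENCY column of abc-iut-reqb-rf-1, not asserted here); the kept set is tier L0 (licence information) — the exact-slack tier L1 of the
ratio of record `ρ` is NOT typed here; nothing here asserts that abc is proved or refuted, or that [IUTchIII] Cor. 3.12 / [IUTchIV] Thm. 1.10 holds or fails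
at any datum, or takes a side on any author; typed ≠ proved; computed ≠ proved. [claim: Mochizuki2012, status: disputed] for every IUT locution.
[cite: Mochizuki2012, IUTchIII Cor. 3.12 p. 173–174, Rmk. 3.9.3 p. 119–120; IUTchIV Prop. 1.4 p. 13, Thm. 1.10 Step (v) p. 27–29, Cor. 2.2 (ii)(iii) p. 42–46]
-/

noncomputable section

open Finset

namespace Summit.ABC.IUTFork.Repair.RH.ReqsideWeightLaws

/-! ## §1. Cell comparisons for a general pilot law -/

/-- **CROSS-DENOMINATOR PILOT ANTITONICITY**: `f/den ≤ g/den′` at the label (`f(j)·den′ ≤ g(j)·den`), `m ≥ 0`: `Cell g den′ ⟹ Cell f den` — a smaller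
pilot order (in either normalisation) licenses at least the same labels; at `den = den′` this is part 1's `cell_of_le_of_cell`; affine `c₁ = 1/2`
(`lawAffine 1`, `den = 2`) against print (`j²`, `den′ = 1`) is the instance `j²·1 ≤ j²·2`. [folklore] -/
theorem cell_of_mul_le_of_cell {f g : ℕ → ℤ} {den den' e m δ rin rout : ℤ} (hden : 0 < den) (hden' : 0 < den') (he : 0 < e)
    (hm : 0 ≤ m) {j : ℕ} (hfg : f j * den' ≤ g j * den) (h : Cell g den' e m δ rin rout j) : Cell f den e m δ rin rout j := by
  unfold Cell at h ⊢
  set A : ℤ := (j : ℤ) * δ + ((j : ℤ) + 1) * rin with hA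
  have h1 : (f j * m - den * A) / (den * e) = (den' * (f j * m - den * A)) / (den' * (den * e)) :=
    (Int.mul_ediv_mul_of_pos _ _ hden').symm
  have h2 : (g j * m - den' * A) / (den' * e) = (den * (g j * m - den' * A)) / (den * (den' * e)) :=
    (Int.mul_ediv_mul_of_pos _ _ hden).symm
  have h3 : den' * (den * e) = den * (den' * e) := by ring
  have hle : den' * (f j * m - den * A) ≤ den * (g j * m - den' * A) := by
    nlinarith [mul_le_mul_of_nonneg_right hfg hm]
  have h4 : (f j * m - den * A) / (den * e) ≤ (g j * m - den' * A) / (den' * e) := by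
    rw [h1, h2, h3]
    exact Int.ediv_le_ediv (mul_pos hden (mul_pos hden' he)) hle
  nlinarith [mul_le_mul_of_nonneg_left h4 he.le]

/-- **k4 HOMOGENEITY of the k1-cell under EVERY law**: scaling the place data `(e, m, δ, r_in, r_out)` by a common `t > 0` leaves the cell unchanged
(`⌊tX/(den·t·e)⌋ = ⌊X/(den·e)⌋`). The print case is abc-iut-reqb-typ-2's `ReqsideShellProfile.lProfile_scale` / rp-d3's `hullCellδ_scale`; the
`l`-profile reading (tower: `e_w`, `δ_w + 1`, radii scale to first order with `l` at fixed `m_q`) is theirs. [folklore] -/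
theorem cell_scale (f : ℕ → ℤ) (den : ℤ) {t e m δ rin rout : ℤ} (ht : 0 < t) (j : ℕ) :
    Cell f den (t * e) (t * m) (t * δ) (t * rin) (t * rout) j ↔ Cell f den e m δ rin rout j := by
  unfold Cell
  have h1 : f j * (t * m) - den * ((j : ℤ) * (t * δ) + ((j : ℤ) + 1) * (t * rin)) =
      t * (f j * m - den * ((j : ℤ) * δ + ((j : ℤ) + 1) * rin)) := by ring
  have h2 : den * (t * e) = t * (den * e) := by ring
  rw [h1, h2, Int.mul_ediv_mul_of_pos _ _ ht]
  set q : ℤ := (f j * m - den * ((j : ℤ) * δ + ((j : ℤ) + 1) * rin)) / (den * e)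
  constructor
  · intro h; nlinarith
  · intro h; nlinarith

/-- **k1 × k3: A LOOSER SHELL LICENSES MORE UNDER EVERY LAW** (`den > 0`, `e > 0`): `δ ≤ δ′`, `r_in ≤ r_in′`, `r_out′ ≤ r_out` carry `Cell f den` at
`(δ, r_in, r_out)` to `(δ′, r_in′, r_out′)` (the floor argument decreases, the right side increases). Print case: reqb-typ-2's
`ReqsideLabelsInd.hullCellδ_mono_shell`. [folklore] -/
theorem cell_mono_shell {f : ℕ → ℤ} {den e m δ δ' rin rin' rout rout' : ℤ} (hden : 0 < den) (he : 0 < e) {j : ℕ} (hδ : δ ≤ δ')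
    (hi : rin ≤ rin') (ho : rout' ≤ rout) (h : Cell f den e m δ rin rout j) : Cell f den e m δ' rin' rout' j := by
  unfold Cell at h ⊢
  have hj : (0 : ℤ) ≤ (j : ℤ) := Nat.cast_nonneg j
  have hle : f j * m - den * ((j : ℤ) * δ' + ((j : ℤ) + 1) * rin') ≤ f j * m - den * ((j : ℤ) * δ + ((j : ℤ) + 1) * rin) := by
    nlinarith [mul_le_mul_of_nonneg_left hδ hj, mul_le_mul_of_nonneg_left hi (by linarith : (0 : ℤ) ≤ (j : ℤ) + 1)]
  have h4 := Int.ediv_le_ediv (mul_pos hden he) hle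
  nlinarith [mul_le_mul_of_nonneg_left h4 he.le, mul_le_mul_of_nonneg_left ho (by linarith : (0 : ℤ) ≤ (j : ℤ) + 1)]

/-- **k1 × k4 `l`-PROFILE UNDER EVERY LAW**: at fixed depth `m`, scaling the allowance `(δ, r_in, r_out)` by `t ≥ 1` (structural signs `0 ≤ δ`, `0 ≤ r_in`,
`r_out ≤ 0`) keeps every licensed label licensed — raising `l` along the tower never un-licenses a label of a fixed law at fixed `m_q` (print case:
reqb-typ-2's `lProfile_mono`). [folklore] -/
theorem cell_lProfile_mono {f : ℕ → ℤ} {den t e m δ rin rout : ℤ} (hden : 0 < den) (he : 0 < e) (ht : 1 ≤ t) (hδ : 0 ≤ δ) (hrin : 0 ≤ rin)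
    (hrout : rout ≤ 0) {j : ℕ} (h : Cell f den (t * e) m δ rin rout j) : Cell f den (t * e) m (t * δ) (t * rin) (t * rout) j :=
  cell_mono_shell hden (mul_pos (by omega) he) (le_mul_of_one_le_left hδ ht) (le_mul_of_one_le_left hrin ht) (by nlinarith) h

/-- Every κ-law is `≥ 1` on labels `≥ 1` (`⌈j^{a/2}⌉ ≥ ⌈1⌉ = 1`), i.e. `den = 1 ≤ f`: its demands are `≥ 0`. [folklore] -/
theorem one_le_lawPow (a : ℕ) {j : ℕ} (hj : 1 ≤ j) : (1 : ℤ) ≤ lawPow a j := by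
  rw [← lawPow_at_one a]; exact lawPow_mono hj

/-- `j² ≤ lawShift a j = (j+a)² − (1+a)² + 1` on labels `j ≥ 1` (difference `2a(j−1) ≥ 0`): the shifted pilot is HEAVIER than print's. [folklore] -/
theorem sq_le_lawShift (a : ℕ) {j : ℕ} (hj : 1 ≤ j) : (j : ℤ) ^ 2 ≤ lawShift a j := by
  unfold lawShift
  have hj' : (1 : ℤ) ≤ (j : ℤ) := by exact_mod_cast hj
  have ha : (0 : ℤ) ≤ (a : ℤ) := Nat.cast_nonneg a
  nlinarith [mul_nonneg ha (by linarith : (0 : ℤ) ≤ (j : ℤ) - 1)]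

/-- `j² ≤ lawAffine c j = c·j²` for `c ≥ 1` (same denominator): the affine pilot `c₁ ≥ 1` is heavier than print's. [folklore] -/
theorem sq_le_lawAffine {c : ℕ} (hc : 1 ≤ c) (j : ℕ) : (j : ℤ) ^ 2 ≤ lawAffine c j := by
  unfold lawAffine
  have hc' : (1 : ℤ) ≤ (c : ℤ) := by exact_mod_cast hc
  nlinarith [sq_nonneg (j : ℤ)]

/-! ## §2. The place threshold `T_f(w)` (tier L0, exact) and the k1 sign theorem -/

open Classical in
/-- **THE PLACE THRESHOLD in label units**: `offDemand f den e m δ r_in r_out L := Σ_{1 ≤ j ≤ L, ¬ Cell_j} (f(j) − den)` — the demand of the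
UNLICENSED labels of the place under the law `f/den` (tier L0: kept = licensed cells, no netting, no segment assumption), so that
`T_f(w) = M_f(w) − K_{L0,f}(w) = (offDemand/den)·m_q(w)·u_w` (REQB-SPEC §6(a)(P2) at `μ₀ = 1`). [claim: Mochizuki2012, status: disputed] -/
@[claim "Mochizuki2012" "disputed"]
def offDemand (f : ℕ → ℤ) (den e m δ rin rout : ℤ) (L : ℕ) : ℤ :=
  ∑ i ∈ Finset.range L, if Cell f den e m δ rin rout (i + 1) then 0 else f (i + 1) - den

open Classical in
/-- **THE KEPT DEMAND in label units** (tier L0): `keptDemand … L := Σ_{1 ≤ j ≤ L, Cell_j} (f(j) − den)`, so `K_{L0,f}(w) = (keptDemand/den)·m_q(w)·u_w`.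
[claim: Mochizuki2012, status: disputed] -/
@[claim "Mochizuki2012" "disputed"]
def keptDemand (f : ℕ → ℤ) (den e m δ rin rout : ℤ) (L : ℕ) : ℤ :=
  ∑ i ∈ Finset.range L, if Cell f den e m δ rin rout (i + 1) then f (i + 1) - den else 0

/-- **`M = K_L0 + T`** at the place: `keptDemand + offDemand = demandSum` (part 1's total demand of the labels `1 … L`). [folklore] -/
theorem keptDemand_add_offDemand (f : ℕ → ℤ) (den e m δ rin rout : ℤ) (L : ℕ) :
    keptDemand f den e m δ rin rout L + offDemand f den e m δ rin rout L = demandSum f den L := by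
  unfold keptDemand offDemand demandSum
  rw [← Finset.sum_add_distrib]
  refine Finset.sum_congr rfl fun i _ => ?_
  split_ifs <;> ring

/-- `T ≥ 0` when the law's demands are `≥ 0` (`den ≤ f` on labels `≥ 1`). [folklore] -/
theorem offDemand_nonneg {f : ℕ → ℤ} {den : ℤ} (hf : ∀ j, 1 ≤ j → den ≤ f j) (e m δ rin rout : ℤ) (L : ℕ) :
    0 ≤ offDemand f den e m δ rin rout L := by
  unfold offDemand
  refine Finset.sum_nonneg fun i _ => ?_
  split_ifs
  · exact le_rfl
  · linarith [hf (i + 1) (Nat.succ_pos i)]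

/-- `K_L0 ≥ 0` likewise. [folklore] -/
theorem keptDemand_nonneg {f : ℕ → ℤ} {den : ℤ} (hf : ∀ j, 1 ≤ j → den ≤ f j) (e m δ rin rout : ℤ) (L : ℕ) :
    0 ≤ keptDemand f den e m δ rin rout L := by
  unfold keptDemand
  refine Finset.sum_nonneg fun i _ => ?_
  split_ifs
  · linarith [hf (i + 1) (Nat.succ_pos i)]
  · exact le_rfl

/-- `T ≤ M` at the place. [folklore] -/
theorem offDemand_le_demandSum {f : ℕ → ℤ} {den : ℤ} (hf : ∀ j, 1 ≤ j → den ≤ f j) (e m δ rin rout : ℤ) (L : ℕ) :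
    offDemand f den e m δ rin rout L ≤ demandSum f den L := by
  have h1 := keptDemand_add_offDemand f den e m δ rin rout L
  have h2 := keptDemand_nonneg hf e m δ rin rout L
  linarith

/-- `T` depends on the law only through its values on labels `≥ 1`. [folklore] -/
theorem offDemand_congr {f g : ℕ → ℤ} (h : ∀ j, 1 ≤ j → f j = g j) (den e m δ rin rout : ℤ) (L : ℕ) :
    offDemand f den e m δ rin rout L = offDemand g den e m δ rin rout L := by
  unfold offDemand
  refine Finset.sum_congr rfl fun i _ => ?_
  have hfg := h (i + 1) (Nat.succ_pos i)
  have hc := cell_congr hfg den e m δ rin rout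
  by_cases hg : Cell g den e m δ rin rout (i + 1)
  · rw [if_pos hg, if_pos (hc.2 hg)]
  · rw [if_neg hg, if_neg (fun hf => hg (hc.1 hf)), hfg]

/-- **THE k1 SIGN THEOREM — `T` IS MONOTONE IN THE PILOT LAW.** At a place with `e > 0`, `m ≥ 0` and a common denominator `den > 0`: if `den ≤ f ≤ g` on
labels `≥ 1`, then `T_f(w) ≤ T_g(w)` — every label unlicensed under `f` is unlicensed under `g` (pilot antitonicity `cell_of_le_of_cell`) and carries no more
demand. NO segment assumption; holds cell set by cell set. Hence pooled over places and data with weights `m_q u_w ≥ 0` (§3): a LIGHTER law never raises the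
licence-only threshold — the sign of the T-word of every k1 row of REQB-TABLE v1. [folklore] -/
theorem offDemand_mono_law {f g : ℕ → ℤ} {den e m δ rin rout : ℤ} (hden : 0 < den) (he : 0 < e) (hm : 0 ≤ m)
    (hf : ∀ j, 1 ≤ j → den ≤ f j) (hfg : ∀ j, 1 ≤ j → f j ≤ g j) (L : ℕ) :
    offDemand f den e m δ rin rout L ≤ offDemand g den e m δ rin rout L := by
  unfold offDemand
  refine Finset.sum_le_sum fun i _ => ?_
  have h1 := hf (i + 1) (Nat.succ_pos i)
  have h2 := hfg (i + 1) (Nat.succ_pos i)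
  by_cases hg : Cell g den e m δ rin rout (i + 1)
  · rw [if_pos hg, if_pos (cell_of_le_of_cell hden he hm h2 hg)]
  · rw [if_neg hg]
    split_ifs
    · linarith
    · linarith

/-- **CROSS-DENOMINATOR SIGN THEOREM** (`f/den ≤ g/den′`, i.e. `f(j)·den′ ≤ g(j)·den` on labels `≥ 1`; `den′ ≤ g` there): `T_f·den′ ≤ T_g·den` in
label units, i.e. `T_f/den ≤ T_g/den′` in mass units — covers affine `c₁ = 1/2` (whose label-1 demand is NEGATIVE, p512285's remark) against print.
[folklore] -/
theorem offDemand_mono_law_den {f g : ℕ → ℤ} {den den' e m δ rin rout : ℤ} (hden : 0 < den) (hden' : 0 < den') (he : 0 < e) (hm : 0 ≤ m)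
    (hg' : ∀ j, 1 ≤ j → den' ≤ g j) (hfg : ∀ j, 1 ≤ j → f j * den' ≤ g j * den) (L : ℕ) :
    offDemand f den e m δ rin rout L * den' ≤ offDemand g den' e m δ rin rout L * den := by
  unfold offDemand
  rw [Finset.sum_mul, Finset.sum_mul]
  refine Finset.sum_le_sum fun i _ => ?_
  have h3 := hg' (i + 1) (Nat.succ_pos i)
  have h2 := hfg (i + 1) (Nat.succ_pos i)
  by_cases hg : Cell g den' e m δ rin rout (i + 1)
  · rw [if_pos hg, if_pos (cell_of_mul_le_of_cell hden hden' he hm h2 hg), zero_mul, zero_mul]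
  · rw [if_neg hg]
    split_ifs
    · nlinarith
    · nlinarith

/-- **VANISHES ⟺ SATURATION**: for a law with demands `≥ 0`, `T_f(w) = 0` iff every label `1 ≤ j ≤ L` is licensed or carries zero demand (`f(j) = den`;
for the laws of record only `j = 1`). [folklore] -/
theorem offDemand_eq_zero_iff {f : ℕ → ℤ} {den : ℤ} (hf : ∀ j, 1 ≤ j → den ≤ f j) (e m δ rin rout : ℤ) (L : ℕ) :
    offDemand f den e m δ rin rout L = 0 ↔ ∀ j, 1 ≤ j → j ≤ L → (Cell f den e m δ rin rout j ∨ f j = den) := by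
  unfold offDemand
  rw [Finset.sum_eq_zero_iff_of_nonneg (fun i _ => by
    split_ifs
    · exact le_rfl
    · linarith [hf (i + 1) (Nat.succ_pos i)])]
  constructor
  · intro h j hj hjL
    obtain ⟨i, rfl⟩ : ∃ i, j = i + 1 := ⟨j - 1, by omega⟩
    have hi := h i (Finset.mem_range.mpr (by omega))
    by_cases hc : Cell f den e m δ rin rout (i + 1)
    · exact Or.inl hc
    · rw [if_neg hc] at hi
      exact Or.inr (by linarith)
  · intro h i hi
    rw [Finset.mem_range] at hi
    rcases h (i + 1) (Nat.succ_pos i) (by omega) with hc | hc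
    · rw [if_pos hc]
    · by_cases hc' : Cell f den e m δ rin rout (i + 1)
      · rw [if_pos hc']
      · rw [if_neg hc', hc, sub_self]

/-- Sufficient side: every label licensed ⟹ `T_f(w) = 0`. [folklore] -/
theorem offDemand_eq_zero_of_forall_cell {f : ℕ → ℤ} {den e m δ rin rout : ℤ} {L : ℕ}
    (h : ∀ j, 1 ≤ j → j ≤ L → Cell f den e m δ rin rout j) : offDemand f den e m δ rin rout L = 0 := by
  unfold offDemand
  refine Finset.sum_eq_zero fun i hi => ?_
  rw [Finset.mem_range] at hi
  rw [if_pos (h (i + 1) (Nat.succ_pos i) (by omega))]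

/-- **STRICT LAWS: VANISHES ⟺ EVERY LABEL LICENSED.** If `f(1) = den` (zero demand at label `1`), `f(j) > den` for `j ≥ 2`, and the structural signs
`δ ≥ 0`, `r_out ≤ r_in` hold (so label `1` is a cell, part 1 `cell_at_one`), then `T_f(w) = 0 ⟺ ∀ 1 ≤ j ≤ L, Cell_j` («`j₀(w) = L`»). [folklore] -/
theorem offDemand_eq_zero_iff_forall_cell {f : ℕ → ℤ} {den e m δ rin rout : ℤ} (hden : 0 < den) (he : 0 < e) (hf1 : f 1 = den)
    (hf : ∀ j, 2 ≤ j → den < f j) (hδ : 0 ≤ δ) (hG : rout ≤ rin) (L : ℕ) :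
    offDemand f den e m δ rin rout L = 0 ↔ ∀ j, 1 ≤ j → j ≤ L → Cell f den e m δ rin rout j := by
  have hf' : ∀ j, 1 ≤ j → den ≤ f j := fun j hj => by
    rcases Nat.lt_or_ge j 2 with h2 | h2
    · have : j = 1 := by omega
      rw [this, hf1]
    · exact (hf j h2).le
  rw [offDemand_eq_zero_iff hf']
  refine ⟨fun h j hj hjL => ?_, fun h j hj hjL => Or.inl (h j hj hjL)⟩
  rcases h j hj hjL with hc | hc
  · exact hc
  · rcases Nat.lt_or_ge j 2 with h2 | h2
    · have : j = 1 := by omega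
      rw [this]; exact cell_at_one hden he hf1 hδ hG
    · exact absurd hc (ne_of_gt (hf j h2))

open Classical in
/-- **EVALUATION ON A SEGMENT PLACE**: if on `{1,…,L}` the licensed labels are exactly `{1,…,J}` (`J ≤ L`; the engines' «seg = 1», print's
`RH.HullCellSlice.exists_sliceBoundary`), then `T_f(w) = demandSum f den L − demandSum f den J` — with part 1's closed forms a polynomial in `(L, J)`.
[folklore] -/
theorem offDemand_eq_of_boundary {f : ℕ → ℤ} {den e m δ rin rout : ℤ} {J L : ℕ} (hJL : J ≤ L)
    (hJ : ∀ j, 1 ≤ j → j ≤ L → (Cell f den e m δ rin rout j ↔ j ≤ J)) :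
    offDemand f den e m δ rin rout L = demandSum f den L - demandSum f den J := by
  rw [demandSum_eq_add_offSegment f den hJL]
  unfold offDemand
  rw [← Finset.sum_range_add_sum_Ico _ hJL]
  have h1 : ∑ i ∈ Finset.range J, (if Cell f den e m δ rin rout (i + 1) then 0 else f (i + 1) - den) = 0 := by
    refine Finset.sum_eq_zero fun i hi => ?_
    rw [Finset.mem_range] at hi
    rw [if_pos ((hJ (i + 1) (Nat.succ_pos i) (by omega)).2 (by omega))]
  have h2 : ∑ i ∈ Finset.Ico J L, (if Cell f den e m δ rin rout (i + 1) then 0 else f (i + 1) - den) =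
      ∑ i ∈ Finset.Ico J L, (f (i + 1) - den) := by
    refine Finset.sum_congr rfl fun i hi => ?_
    rw [Finset.mem_Ico] at hi
    have hn : ¬ Cell f den e m δ rin rout (i + 1) := fun hc => by
      have := (hJ (i + 1) (Nat.succ_pos i) (by omega)).1 hc
      omega
    rw [if_neg hn]
  rw [h1, h2]
  ring

/-- … and `K_{L0,f}(w) = demandSum f den J` on a segment place. [folklore] -/
theorem keptDemand_eq_of_boundary {f : ℕ → ℤ} {den e m δ rin rout : ℤ} {J L : ℕ} (hJL : J ≤ L)
    (hJ : ∀ j, 1 ≤ j → j ≤ L → (Cell f den e m δ rin rout j ↔ j ≤ J)) :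
    keptDemand f den e m δ rin rout L = demandSum f den J := by
  have h1 := keptDemand_add_offDemand f den e m δ rin rout L
  have h2 := offDemand_eq_of_boundary hJL hJ
  linarith

/-- **THE κ-CHAIN `T(κ = 1) ≤ T(3/2) ≤ T(2) ≤ T(5/2) ≤ T(3)`** at every place (`e > 0`, `m ≥ 0`): `a ≤ b ⟹ T_{lawPow a} ≤ T_{lawPow b}`
(`lawPow_mono_exp`). [folklore] -/
theorem offDemand_lawPow_mono {a b : ℕ} (hab : a ≤ b) {e m : ℤ} (he : 0 < e) (hm : 0 ≤ m) (δ rin rout : ℤ) (L : ℕ) :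
    offDemand (lawPow a) 1 e m δ rin rout L ≤ offDemand (lawPow b) 1 e m δ rin rout L :=
  offDemand_mono_law one_pos he hm (fun _ hj => one_le_lawPow a hj) (fun _ hj => lawPow_mono_exp hj hab) L

/-- The chain spelled out for `κ ∈ {1, 3/2, 2, 5/2, 3}` = `lawPow 2, 3, 4, 5, 6`. [folklore] -/
theorem offDemand_kappa_chain {e m : ℤ} (he : 0 < e) (hm : 0 ≤ m) (δ rin rout : ℤ) (L : ℕ) :
    offDemand (lawPow 2) 1 e m δ rin rout L ≤ offDemand (lawPow 3) 1 e m δ rin rout L ∧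
      offDemand (lawPow 3) 1 e m δ rin rout L ≤ offDemand (lawPow 4) 1 e m δ rin rout L ∧
        offDemand (lawPow 4) 1 e m δ rin rout L ≤ offDemand (lawPow 5) 1 e m δ rin rout L ∧
          offDemand (lawPow 5) 1 e m δ rin rout L ≤ offDemand (lawPow 6) 1 e m δ rin rout L :=
  ⟨offDemand_lawPow_mono (by norm_num) he hm δ rin rout L, offDemand_lawPow_mono (by norm_num) he hm δ rin rout L,
    offDemand_lawPow_mono (by norm_num) he hm δ rin rout L, offDemand_lawPow_mono (by norm_num) he hm δ rin rout L⟩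

/-- Calibration: `T_{lawPow 4} = T_print` (`lawPow 4 = j²`), `T_{lawPow 2} = T_{κ=1}` (`lawPow 2 = j`), `T_{lawPow 6} = T_{j³}`. [folklore] -/
theorem offDemand_lawPow_two_four_six (e m δ rin rout : ℤ) (L : ℕ) :
    offDemand (lawPow 2) 1 e m δ rin rout L = offDemand (fun j => (j : ℤ)) 1 e m δ rin rout L ∧
      offDemand (lawPow 4) 1 e m δ rin rout L = offDemand (fun j => (j : ℤ) ^ 2) 1 e m δ rin rout L ∧
        offDemand (lawPow 6) 1 e m δ rin rout L = offDemand (fun j => (j : ℤ) ^ 3) 1 e m δ rin rout L :=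
  ⟨offDemand_congr (fun j _ => lawPow_two j) 1 e m δ rin rout L, offDemand_congr (fun j _ => lawPow_four j) 1 e m δ rin rout L,
    offDemand_congr (fun j _ => lawPow_six j) 1 e m δ rin rout L⟩

/-- **SHIFT rows: `T_print ≤ T_shift(a)`** at every place (`e > 0`, `m ≥ 0`) — the INCREASES side of rows S-k1-shift1, S-k1-shift2. [folklore] -/
theorem offDemand_sq_le_shift (a : ℕ) {e m : ℤ} (he : 0 < e) (hm : 0 ≤ m) (δ rin rout : ℤ) (L : ℕ) :
    offDemand (fun j => (j : ℤ) ^ 2) 1 e m δ rin rout L ≤ offDemand (lawShift a) 1 e m δ rin rout L :=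
  offDemand_mono_law one_pos he hm (fun j hj => by have h1j : (1 : ℤ) ≤ j := (by exact_mod_cast hj); nlinarith)
    (fun _ hj => sq_le_lawShift a hj) L

/-- **AFFINE `c₁ ≥ 1`: `T_print ≤ T_affine(c)`** (same denominator `1`) — the INCREASES side of row S-k1-affine2. [folklore] -/
theorem offDemand_sq_le_affine {c : ℕ} (hc : 1 ≤ c) {e m : ℤ} (he : 0 < e) (hm : 0 ≤ m) (δ rin rout : ℤ) (L : ℕ) :
    offDemand (fun j => (j : ℤ) ^ 2) 1 e m δ rin rout L ≤ offDemand (lawAffine c) 1 e m δ rin rout L :=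
  offDemand_mono_law one_pos he hm (fun j hj => by have h1j : (1 : ℤ) ≤ j := (by exact_mod_cast hj); nlinarith)
    (fun j _ => sq_le_lawAffine hc j) L

/-- **AFFINE `c₁ = 1/2` (`lawAffine 1`, `den = 2`): `T_affine(½) ≤ 2·T_print`** in label units, i.e. `T_affine(½)/2 ≤ T_print/1` in mass units — the REDUCES
side of row S-k1-affine1/2. [folklore] -/
theorem offDemand_affineHalf_le_sq {e m : ℤ} (he : 0 < e) (hm : 0 ≤ m) (δ rin rout : ℤ) (L : ℕ) :
    offDemand (lawAffine 1) 2 e m δ rin rout L ≤ 2 * offDemand (fun j => (j : ℤ) ^ 2) 1 e m δ rin rout L := by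
  have h := offDemand_mono_law_den (f := lawAffine 1) (g := fun j => (j : ℤ) ^ 2) (den := 2) (den' := 1) (δ := δ) (rin := rin)
    (rout := rout) two_pos one_pos he hm
    (fun j hj => by have h1j : (1 : ℤ) ≤ j := (by exact_mod_cast hj); nlinarith)
    (fun j _ => by unfold lawAffine; push_cast; nlinarith [sq_nonneg (j : ℤ)]) L
  linarith

/-- **SATURATION ⟹ VANISHES, `κ = 1`**: `m ≤ δ + (r_in − r_out)` (with `e > 0`, `δ ≥ 0`, `r_out ≤ r_in`) ⟹ `T_{κ=1}(w) = 0` for EVERY label range `L` — an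
`L`-FREE condition (part 1 `cell_id_of_le`): the k1 × k4 reading «VANISHES at every `l`, tabulated or not, once `m_q ≤ D + G`». [folklore] -/
theorem offDemand_id_eq_zero {e m δ rin rout : ℤ} (he : 0 < e) (hδ : 0 ≤ δ) (hG : rout ≤ rin) (h : m ≤ δ + (rin - rout)) (L : ℕ) :
    offDemand (fun j => (j : ℤ)) 1 e m δ rin rout L = 0 :=
  offDemand_eq_zero_of_forall_cell fun _ hj _ => cell_id_of_le he hδ hG h hj

/-- **SATURATION ⟹ VANISHES, `κ = 3/2`**: `⌈√L⌉·m ≤ δ + (r_in − r_out)` ⟹ `T_{κ=3/2}(w) = 0` on `{1..L}` (part 1 `cell_lawPow_three_all`). [folklore] -/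
theorem offDemand_lawPow_three_eq_zero {e m δ rin rout : ℤ} (he : 0 < e) (hm : 0 ≤ m) (hG : rout ≤ rin) {L : ℕ}
    (h : (ceilSqrt L : ℤ) * m ≤ δ + (rin - rout)) : offDemand (lawPow 3) 1 e m δ rin rout L = 0 :=
  offDemand_eq_zero_of_forall_cell fun _ hj hjL => cell_lawPow_three_all he hm hG h hj hjL

/-- **SATURATION ⟹ VANISHES, print**: `L·m ≤ δ + (r_in − r_out)` ⟹ `T_print(w) = 0` on `{1..L}` (part 1 `cell_sq_all`). [folklore] -/
theorem offDemand_sq_eq_zero {e m δ rin rout : ℤ} (he : 0 < e) (hm : 0 ≤ m) (hG : rout ≤ rin) {L : ℕ}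
    (h : (L : ℤ) * m ≤ δ + (rin - rout)) : offDemand (fun j => (j : ℤ) ^ 2) 1 e m δ rin rout L = 0 :=
  offDemand_eq_zero_of_forall_cell fun _ hj hjL => cell_sq_all he hm hG h hj hjL

end Summit.ABC.IUTFork.Repair.RH.ReqsideWeightLaws

end
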